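/-
Copyright (c) 2026 the pub-hodgecm-mathlib formalisation cell (harness21).  Prover seat hodgecm-mathlib-K2E3-p37 (g3), Track B «K2-LIT»,
#184♮ = hLiu418 = `stmt-HodgeConjecture-24832`; socket #41, KIND W, (iii-fin) row (KW-fin-stab), pole (R): the χ-CONDUCTOR LETTER as its own S-file (KW desk F0P2-p08 (g4)
deal 01:49:49Z 2026-09-05; architect K2E3-p06 (g7); consumer F0P2-p09 (g3) `K2LiuKindWFiniteRadiusPlaceFunctions`).
THEOREMS ONLY (no `def`, no `instance`, no notation, no named-fact hypothesis, no `sorry`); lane `--supports stmt-HodgeConjecture-24832` (count-neutral helper).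
-/
import Literature.NumberTheory.GaloisRepresentations.HeckeCharacterConductorExponentProofs  -- ★ `conductorExponentAt`, `isTrivialOnHigherUnitsAt_conductorExponentAt`, `finite_setOf_conductorExponentAt_ne_zero`
import Literature.NumberTheory.Automorphic.UnitaryGroupAutomorphicRep                   -- ★ `PlacesOver E v` (`w.under (𝓞 F) = v`)
import HarnessLib

/-!
# Crux `HLiu418`, socket #41, KIND W, (KW-fin-stab) pole (R) — `K2LiuHeckeLocalConductorLetters`: THE CONDUCTOR LETTER OF A HECKE CHARACTER, BY VALUE AND FINITE-SUPPORT
# (`χ_w(x) = 1` whenever `|x − 1|_w ≤ |ϖ_w|^{f(χ_w)}` and `|x|_w = 1`; `f(χ_w) = 0` off a finite set of places)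

Cell `hodgecm-mathlib`, crux item hLiu418 = `stmt-HodgeConjecture-24832` (helper lane `--supports … --as helper`, count-neutral), route of record `HCCMUnconditional`;
squad K2 ∕ K2Liu, road `K2_Liu`, socket #41 `sig_K2LiuSiegelEisensteinContinuation`, KIND W, (iii-fin) row, pole (R).  ★ p864290 `K2LiuLocalLeviSupplyExplicit.hsup_of_radius`
(this seat) supplies the Siegel–Levi moves of Karel's lemma at the explicit radius `1 + Σ_{w∣v} cχ w` from a BY-VALUE conductor letter
`hχc : ∀ w x (hx : IsUnit x), Valued.v (x − 1) ≤ Valued.v (ϖ w) ^ cχ w → Valued.v x = 1 → χ_w(x) = 1`; the (iii-fin) size letter needs `cχ = 0` off a FIXED finite set of places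
(K2E3-p06 (g7)'s ARCHITECT NOTE #1).  THIS FILE pays that letter for the local components of a Hecke character `χ` of a number field `K`, with `cχ w := f(χ_w)` the conductor
exponent (★ Lit `HeckeCharacter.conductorExponentAt`; Tate's thesis §2.3):
* §1 **`localComponent_eq_one_of_valued_sub_one_le`** — pointwise: `|x − 1|_w ≤ exp(−f(χ_w))`, `|x|_w = 1` ⟹ `χ_w(x) = 1` (★ `isTrivialOnHigherUnitsAt_conductorExponentAt`; the unit of
  `𝒪_w` under `x`); **`exists_conductor_letters`** — `∃ (Tχ : Finset) (cχ), (∀ w ∉ Tχ, cχ w = 0) ∧ hχc` at any uniformisers `ϖ_w` (`Tχ` = the finitely many places with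
  `f(χ_w) ≠ 0`, ★ `finite_setOf_conductorExponentAt_ne_zero`) — the quantitative sibling of ★ p864084 §1 `exists_nhds_localComponent_eq_one`.
* §2 **`exists_conductor_letters_placesOver`** — the same read over the places `w ∣ v` of a finite extension `E/F` (`PlacesOver E v`): `∃ (TF : Finset 𝔭_F) (cχ)`,
  `cχ w = 0` for every `w` over `v ∉ TF` (`TF :=` the places below `Tχ`), and `hχc` per `(v, w)` — the letters `(cχ, hχc)` of ★ `hsup_of_radius` at
  `χv w := χ.localComponent w.1`, `ϖ := fun w => ϖ w.1`, `cχ := fun w => cχ w.1`.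
[TateThesis1967, §2.3] [LiXu2026, §2.1.1] [CasselsFrohlichANT1967, Ch. VII §1.1].
HONEST LABEL.  Count-neutral helper, closes no socket: `HC_CM` is proved only modulo the 7 printed citations (2 remaining named inputs: hLiu418 = `stmt-HodgeConjecture-24832`,
h413 = `stmt-HodgeConjecture-24833`) until rung 0 closes.

## References
* [TateThesis1967] J. Tate, *Fourier analysis in number fields and Hecke's zeta-functions*, in Cassels–Fröhlich (1967): §2.3 (the conductor of a quasi-character).
* [LiXu2026] Li–Xu, arXiv:2502.12648: §2.1.1 (the exponent of conductor `f(χ_v)`).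
* [CasselsFrohlichANT1967] J. W. S. Cassels, A. Fröhlich (eds.), *Algebraic Number Theory* (1967): Ch. VII §1.1.
-/

set_option autoImplicit false
set_option linter.dupNamespace false -- the mandated namespace repeats `HodgeConjecture.HodgeConjecture`

noncomputable section

open NumberField IsDedekindDomain
open Literature.NumberTheory.Automorphic Literature.NumberTheory.Automorphic.UnitaryGroup Literature.NumberTheory.GaloisRepresentations

namespace Summit.HodgeConjecture.HodgeConjecture.Cruxes.HLiu418.K2LiuHeckeLocalConductorLetters

/-! ## §1 The conductor letter at one place, and with finite support over the places of `K` -/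

section OneField

variable {K : Type} [Field K] [NumberField K]

/-- **`χ_w(x) = 1` FOR `|x − 1|_w ≤ exp(−f(χ_w))`, `|x|_w = 1`** (Tate: `χ_w` is trivial on `1 + 𝔭_w^{f(χ_w)}`, ★ Lit `isTrivialOnHigherUnitsAt_conductorExponentAt`; an `x` with
`|x|_w = 1` is the value of a unit of `𝒪_w`). [cite: TateThesis1967, §2.3] [cite: LiXu2026, §2.1.1] -/
theorem localComponent_eq_one_of_valued_sub_one_le (χ : HeckeCharacter K) (w : HeightOneSpectrum (𝓞 K)) (x : w.adicCompletion K) (hx : IsUnit x)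
    (h1 : Valued.v (x - 1) ≤ WithZero.exp (-(χ.conductorExponentAt w : ℤ))) (h2 : Valued.v x = 1) :
    χ.localComponent w hx.unit = 1 := by
  have hx0 : x ≠ 0 := fun h => by
    rw [h, map_zero] at h2
    exact zero_ne_one h2
  have hxint : x ∈ w.adicCompletionIntegers K := (HeightOneSpectrum.mem_adicCompletionIntegers _ _ _).2 h2.le
  have hxinv : x⁻¹ ∈ w.adicCompletionIntegers K := by
    rw [HeightOneSpectrum.mem_adicCompletionIntegers, map_inv₀, h2, inv_one]
  set u : (w.adicCompletionIntegers K)ˣ :=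
    ⟨⟨x, hxint⟩, ⟨x⁻¹, hxinv⟩, Subtype.ext (mul_inv_cancel₀ hx0), Subtype.ext (inv_mul_cancel₀ hx0)⟩ with hu
  have h := χ.isTrivialOnHigherUnitsAt_conductorExponentAt w u h1
  have heq : Units.map ((w.adicCompletionIntegers K).subtype : _ →* _) u = hx.unit := Units.ext rfl
  rw [heq] at h
  exact h

/-- **THE CONDUCTOR LETTER OF `χ`, BY VALUE, FINITE SUPPORT.**  For uniformisers `ϖ_w` (`|ϖ_w| = exp(−1)`): with `cχ w := f(χ_w)` and `Tχ :=` the finitely many places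
where `f(χ_w) ≠ 0` (★ Lit `finite_setOf_conductorExponentAt_ne_zero`; `f = 0` ⟺ unramified), `cχ = 0` off `Tχ` and `χ_w(x) = 1` whenever `|x − 1|_w ≤ |ϖ_w|^{cχ w}`, `|x|_w = 1`.
[cite: TateThesis1967, §2.3] [cite: LiXu2026, §2.1.1] -/
theorem exists_conductor_letters (χ : HeckeCharacter K) (ϖ : ∀ w : HeightOneSpectrum (𝓞 K), w.adicCompletion K)
    (hϖ : ∀ w, Valued.v (ϖ w) = WithZero.exp (-1 : ℤ)) :
    ∃ (Tχ : Finset (HeightOneSpectrum (𝓞 K))) (cχ : HeightOneSpectrum (𝓞 K) → ℕ), (∀ w ∉ Tχ, cχ w = 0) ∧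
      ∀ (w : HeightOneSpectrum (𝓞 K)) (x : w.adicCompletion K) (hx : IsUnit x),
        Valued.v (x - 1) ≤ Valued.v (ϖ w) ^ cχ w → Valued.v x = 1 → χ.localComponent w hx.unit = 1 := by
  refine ⟨χ.finite_setOf_conductorExponentAt_ne_zero.toFinset, fun w => χ.conductorExponentAt w, fun w hw => ?_, fun w x hx h1 h2 => ?_⟩
  · by_contra h
    exact hw (χ.finite_setOf_conductorExponentAt_ne_zero.mem_toFinset.2 h)
  · refine localComponent_eq_one_of_valued_sub_one_le χ w x hx ?_ h2
    have hpow : Valued.v (ϖ w) ^ χ.conductorExponentAt w = WithZero.exp (-(χ.conductorExponentAt w : ℤ)) := by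
      rw [hϖ w, ← WithZero.exp_nsmul, nsmul_eq_mul, mul_neg_one]
    rw [← hpow]
    exact h1

end OneField

/-! ## §2 The letter read over the places `w ∣ v` of an extension `E/F` -/

section PlacesOver

variable (F : Type) [Field F] (E : Type) [Field E] [NumberField E] [Algebra F E]

/-- **THE CONDUCTOR LETTER OVER `PlacesOver E v`**: a finite set `TF` of places of `F` (the places below `Tχ`) such that `cχ w = 0` for every `w` over `v ∉ TF`, and the letter
`hχc` of ★ `K2LiuLocalLeviSupplyExplicit.hsup_of_radius` at `χv w := χ.localComponent w.1`, `ϖ := fun w => ϖ w.1`, `cχ := fun w => cχ w.1`, for EVERY `v`.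
[cite: TateThesis1967, §2.3] [cite: CasselsFrohlichANT1967, Ch. VII §1.1] -/
theorem exists_conductor_letters_placesOver (χ : HeckeCharacter E) (ϖ : ∀ w : HeightOneSpectrum (𝓞 E), w.adicCompletion E)
    (hϖ : ∀ w, Valued.v (ϖ w) = WithZero.exp (-1 : ℤ)) :
    ∃ (TF : Finset (HeightOneSpectrum (𝓞 F))) (cχ : HeightOneSpectrum (𝓞 E) → ℕ),
      (∀ v : HeightOneSpectrum (𝓞 F), v ∉ TF → ∀ w : PlacesOver E v, cχ w.1 = 0) ∧
      ∀ (v : HeightOneSpectrum (𝓞 F)) (w : PlacesOver E v) (x : w.1.adicCompletion E) (hx : IsUnit x),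
        Valued.v (x - 1) ≤ Valued.v (ϖ w.1) ^ cχ w.1 → Valued.v x = 1 → χ.localComponent w.1 hx.unit = 1 := by
  classical
  obtain ⟨Tχ, cχ, hc, hχc⟩ := exists_conductor_letters χ ϖ hϖ
  refine ⟨Tχ.image (fun w => w.under (𝓞 F)), cχ, fun v hv w => hc w.1 (fun hw => hv ?_), fun v w x hx h1 h2 => hχc w.1 x hx h1 h2⟩
  exact Finset.mem_image.2 ⟨w.1, hw, w.2⟩

end PlacesOver

end Summit.HodgeConjecture.HodgeConjecture.Cruxes.HLiu418.K2LiuHeckeLocalConductorLetters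

end
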